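import Literature.Topology.FourManifolds.OneManifoldVectorField
import Literature.Topology.FourManifolds.FlowsProofs
import Mathlib.Analysis.Calculus.Implicit
import Mathlib.Analysis.Convex.Contractible
import HarnessLib

/-!
# Compact connected oriented `1`-manifolds: the complement of a point is an open interval

Topic `Literature/Topology/FourManifolds`, sequel to `OneManifoldVectorField.lean`. Milnor,
*Topology from the Differentiable Viewpoint* (1965), Appendix "Classifying one-manifolds": a
smooth connected `1`-manifold is diffeomorphic to the circle or to an interval. This file
proves, by a different (flow) argument and in the weak form needed for homotopy `1`-spheres
(Kervaire–Milnor 1963, p. 507: "Clearly `Θ₁` is zero"; consumer: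
`HomotopySpheresSumDimOne.lean`), that **a compact connected oriented smooth `1`-manifold `M`
minus any point is homeomorphic to an open interval, hence contractible**:

* `Literature.Topology.FourManifolds.orbitHomeomorph` — `(0, T) ≃ₜ M ∖ {p}` for the period `T`
  of the flow through `p`;
* `Literature.Topology.FourManifolds.contractibleSpace_compl_singleton_of_vectorField`,
  `Literature.Topology.FourManifolds.contractibleSpace_compl_singleton_of_smoothOrientation_one`
  (**proved**, no named facts).

## Proof

Let `V` be a nowhere vanishing smooth vector field on `M` (`exists_vectorField_ne_zero`, from
the orientation) and `t ↦ flow t p` its complete flow through `p` (tree theorems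
`Literature.Topology.FourManifolds.flow`, `flow_add`, `isMIntegralCurve_flow`, `contMDiff_flow`
of `FlowsProofs.lean`; Lee 2012, Thm. 9.12). In a chart the curve has nonzero velocity, so by
the inverse function theorem (Mathlib's `HasStrictFDerivAt.map_nhds_eq_of_surj`) it maps
neighbourhoods onto neighbourhoods: **every flow curve is an open map** (`isOpenMap_flow`). Hence
orbits are open; they partition `M`, so by connectedness **the orbit of `p` is all of `M`**
(`range_flow_eq_univ`). The stabiliser `{t | flow t p = p}` is a closed subgroup of `ℝ`, hence
dense or cyclic (Mathlib's `AddSubgroup.dense_or_cyclic`); it is not `ℝ` (a point of a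
`1`-manifold is not open) and not `0` (else the orbit map would be a continuous open bijection
`ℝ → M`, a homeomorphism onto a compact space), so it is `ℤ T` with `T > 0`
(`exists_stabilizer_eq_zmultiples`), and the orbit map restricted to one period `(0, T)` is a
continuous open bijection onto `M ∖ {p}` (`orbitHomeomorph`).

## References

* J. Milnor, *Topology from the Differentiable Viewpoint* (1965), Appendix: Classifying
  one-manifolds. [MilnorTDV1965]
* J. M. Lee, *Introduction to Smooth Manifolds*, 2nd ed. (2012), Thm. 9.12 (flows).
  [LeeSmoothManifolds2013]
* M. Kervaire, J. Milnor, *Groups of homotopy spheres I*, Ann. of Math. 77 (1963), p. 507.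
  [KervaireMilnorAnnals1963]
-/

open scoped Manifold ContDiff Topology
open Set Function Filter Module

noncomputable section

namespace Literature.Topology.FourManifolds

/-- Local notation: `𝔼 n` is the model Euclidean space `EuclideanSpace ℝ (Fin n)`. -/
local notation "𝔼 " n:arg => EuclideanSpace ℝ (Fin n)

section Flow

variable {M : Type*} [TopologicalSpace M] [ChartedSpace (𝔼 1) M] [IsManifold (𝓡 1) ∞ M]
  [T2Space M] [CompactSpace M]
  {V : Π x : M, TangentSpace (𝓡 1) x}

/-! ### Flow curves of a nowhere vanishing field are open maps -/

/-- Curves of the flow of a smooth vector field on a compact manifold are smooth (joint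
smoothness of the flow, `contMDiff_flow`; Lee 2012, Thm. 9.12). [cite: LeeSmoothManifolds2013, Thm. 9.12] -/
theorem contMDiff_flow_curve
    (hV : ContMDiff (𝓡 1) (𝓡 1).tangent ∞ (fun x => (⟨x, V x⟩ : TangentBundle (𝓡 1) M))) (p : M) :
    ContMDiff 𝓘(ℝ, ℝ) (𝓡 1) ∞ (flow hV p) :=
  (contMDiff_flow hV).comp (contMDiff_id.prodMk contMDiff_const)

/-- In `ℝ¹`, a nonzero vector spans: `c ↦ c • w` is onto. [folklore] -/
theorem DimOne.range_toSpanSingleton {w : 𝔼 1} (hw : w ≠ 0) :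
    LinearMap.range ((ContinuousLinearMap.toSpanSingleton ℝ w : ℝ →L[ℝ] 𝔼 1) : ℝ →ₗ[ℝ] 𝔼 1) = ⊤ := by
  have hw0 : w 0 ≠ 0 := fun h => hw ((DimOne.eq_zero_iff w).2 h)
  refine LinearMap.range_eq_top.2 fun v => ⟨v 0 / w 0, ?_⟩
  change (v 0 / w 0) • w = v
  have hw' := DimOne.eq_smul_e₀ w
  calc (v 0 / w 0) • w = (v 0 / w 0) • ((w 0) • DimOne.e₀) := by rw [← hw']
    _ = (v 0) • DimOne.e₀ := by rw [smul_smul, div_mul_cancel₀ _ hw0]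
    _ = v := (DimOne.eq_smul_e₀ v).symm

/-- **Flow curves of a nowhere vanishing field on a `1`-manifold map neighbourhoods onto
neighbourhoods**: `map (flow · p) (𝓝 t₀) = 𝓝 (flow t₀ p)`. In the chart at `flow t₀ p` the
curve has derivative the (nonzero) field vector there (Mathlib's
`IsMIntegralCurveAt.eventually_hasDerivAt`), it is `C^∞`, hence strictly differentiable with onto
derivative `ℝ → ℝ¹`, so the inverse function theorem in the form
`HasStrictFDerivAt.map_nhds_eq_of_surj` applies; the chart inverse carries neighbourhoods back.
[folklore] -/
theorem map_nhds_flow_eq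
    (hV : ContMDiff (𝓡 1) (𝓡 1).tangent ∞ (fun x => (⟨x, V x⟩ : TangentBundle (𝓡 1) M)))
    (hV0 : ∀ x, V x ≠ 0) (p : M) (t₀ : ℝ) :
    map (flow hV p) (𝓝 t₀) = 𝓝 (flow hV p t₀) := by
  set γ := flow hV p with hγ_def
  set x₀ := γ t₀ with hx₀
  set ψ : ℝ → 𝔼 1 := extChartAt (𝓡 1) x₀ ∘ γ with hψ
  have hγ : IsMIntegralCurve γ V := isMIntegralCurve_flow hV p
  -- the derivative of `ψ` at `t₀` is `V x₀ ≠ 0`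
  have hd : HasDerivAt ψ (V x₀) t₀ := by
    have h := (hγ.isMIntegralCurveAt t₀).eventually_hasDerivAt.self_of_nhds
    rwa [tangentCoordChange_self (mem_extChartAt_source _)] at h
  -- `ψ` is smooth, hence strictly differentiable
  have hψs : ContDiffAt ℝ ∞ ψ t₀ := by
    rw [← contMDiffAt_iff_contDiffAt]
    exact (contMDiffAt_extChartAt' (mem_chart_source _ x₀)).comp t₀ (contMDiff_flow_curve hV p t₀)
  have hstrict : HasStrictFDerivAt ψ (ContinuousLinearMap.toSpanSingleton ℝ (V x₀)) t₀ := by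
    rw [← hasStrictDerivAt_iff_hasStrictFDerivAt, ← hd.deriv]
    exact hψs.hasStrictDerivAt (by simp)
  have hmapψ : map ψ (𝓝 t₀) = 𝓝 (ψ t₀) :=
    hstrict.map_nhds_eq_of_surj (DimOne.range_toSpanSingleton (hV0 x₀))
  -- `γ = chart⁻¹ ∘ ψ` near `t₀`
  have hev : γ =ᶠ[𝓝 t₀] (extChartAt (𝓡 1) x₀).symm ∘ ψ := by
    have hsrc : ∀ᶠ t in 𝓝 t₀, γ t ∈ (extChartAt (𝓡 1) x₀).source :=
      hγ.continuous.continuousAt.eventually_mem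
        ((isOpen_extChartAt_source x₀).mem_nhds (mem_extChartAt_source x₀))
    filter_upwards [hsrc] with t ht
    exact ((extChartAt (𝓡 1) x₀).left_inv ht).symm
  rw [Filter.map_congr hev, ← Filter.map_map, hmapψ]
  have h := map_extChartAt_symm_nhdsWithin_range (I := 𝓡 1) x₀
  rwa [ModelWithCorners.Boundaryless.range_eq_univ, nhdsWithin_univ] at h

/-- **Flow curves of a nowhere vanishing field on a `1`-manifold are open maps.** [folklore] -/
theorem isOpenMap_flow
    (hV : ContMDiff (𝓡 1) (𝓡 1).tangent ∞ (fun x => (⟨x, V x⟩ : TangentBundle (𝓡 1) M)))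
    (hV0 : ∀ x, V x ≠ 0) (p : M) : IsOpenMap (flow hV p) :=
  isOpenMap_iff_nhds_le.2 fun t => (map_nhds_flow_eq hV hV0 p t).ge

/-! ### Orbits, stabilisers and periods -/

/-- Two times give the same point of a flow curve iff their difference stabilises the initial
point (group law of the flow). [folklore] -/
theorem flow_eq_flow_iff
    (hV : ContMDiff (𝓡 1) (𝓡 1).tangent ∞ (fun x => (⟨x, V x⟩ : TangentBundle (𝓡 1) M)))
    (p : M) (s t : ℝ) : flow hV p s = flow hV p t ↔ flow hV p (s - t) = p := by
  constructor
  · intro h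
    calc flow hV p (s - t) = flow hV (flow hV p s) (-t) := by rw [sub_eq_add_neg, flow_add]
      _ = flow hV (flow hV p t) (-t) := by rw [h]
      _ = p := flow_neg_flow hV p t
  · intro h
    calc flow hV p s = flow hV p ((s - t) + t) := by rw [sub_add_cancel]
      _ = flow hV (flow hV p (s - t)) t := flow_add hV p _ _
      _ = flow hV p t := by rw [h]

/-- **On a connected compact `1`-manifold every orbit of a nowhere vanishing field is the whole
manifold**: orbits are open (`isOpenMap_flow`) and partition `M`, so each is clopen. [folklore] -/
theorem range_flow_eq_univ [ConnectedSpace M]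
    (hV : ContMDiff (𝓡 1) (𝓡 1).tangent ∞ (fun x => (⟨x, V x⟩ : TangentBundle (𝓡 1) M)))
    (hV0 : ∀ x, V x ≠ 0) (p : M) : range (flow hV p) = univ := by
  refine IsClopen.eq_univ ⟨?_, (isOpenMap_flow hV hV0 p).isOpen_range⟩ ⟨p, 0, flow_zero hV p⟩
  rw [← isOpen_compl_iff, isOpen_iff_forall_mem_open]
  intro q hq
  refine ⟨range (flow hV q), ?_, (isOpenMap_flow hV hV0 q).isOpen_range, ⟨0, flow_zero hV q⟩⟩
  rintro _ ⟨s, rfl⟩ ⟨t, ht⟩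
  apply hq
  refine ⟨t + -s, ?_⟩
  rw [flow_add, ht, flow_neg_flow]

/-- The **stabiliser** of a point under the flow: the subgroup of times `t` with `flow t p = p`.
[folklore] -/
def stabilizer
    (hV : ContMDiff (𝓡 1) (𝓡 1).tangent ∞ (fun x => (⟨x, V x⟩ : TangentBundle (𝓡 1) M)))
    (p : M) : AddSubgroup ℝ where
  carrier := {t | flow hV p t = p}
  zero_mem' := flow_zero hV p
  add_mem' := fun {s t} hs ht => by
    simp only [mem_setOf_eq] at hs ht ⊢
    rw [flow_add, hs, ht]
  neg_mem' := fun {t} ht => by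
    simp only [mem_setOf_eq] at ht ⊢
    calc flow hV p (-t) = flow hV (flow hV p t) (-t) := by rw [ht]
      _ = p := flow_neg_flow hV p t

/-- Membership in the stabiliser, definitionally. [folklore] -/
theorem mem_stabilizer_iff
    (hV : ContMDiff (𝓡 1) (𝓡 1).tangent ∞ (fun x => (⟨x, V x⟩ : TangentBundle (𝓡 1) M)))
    {p : M} {t : ℝ} : t ∈ stabilizer hV p ↔ flow hV p t = p := Iff.rfl

/-- The stabiliser is closed (continuity of the flow curve). [folklore] -/
theorem isClosed_stabilizer
    (hV : ContMDiff (𝓡 1) (𝓡 1).tangent ∞ (fun x => (⟨x, V x⟩ : TangentBundle (𝓡 1) M)))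
    (p : M) : IsClosed (stabilizer hV p : Set ℝ) :=
  isClosed_eq (isMIntegralCurve_flow hV p).continuous continuous_const

omit [IsManifold (𝓡 1) ∞ M] [T2Space M] [CompactSpace M] in
/-- A point of a `1`-manifold is not open (its chart image would be an open point of `ℝ¹`).
[folklore] -/
theorem not_isOpen_singleton_of_chartedSpace_one (p : M) : ¬ IsOpen ({p} : Set M) := by
  intro h
  have h1 : IsOpen ((chartAt (𝔼 1) p) '' {p}) :=
    (chartAt (𝔼 1) p).isOpen_image_of_subset_source h
      (singleton_subset_iff.2 (mem_chart_source _ p))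
  rw [image_singleton, isOpen_singleton_iff_punctured_nhds] at h1
  haveI : Nontrivial (𝔼 1) := ⟨⟨DimOne.e₀, 0, DimOne.e₀_ne_zero⟩⟩
  exact (inferInstance : NeBot (𝓝[≠] ((chartAt (𝔼 1) p) p))).ne h1

/-- The stabiliser of a point is a proper subgroup: otherwise the (open) orbit is the point.
[folklore] -/
theorem stabilizer_ne_top
    (hV : ContMDiff (𝓡 1) (𝓡 1).tangent ∞ (fun x => (⟨x, V x⟩ : TangentBundle (𝓡 1) M)))
    (hV0 : ∀ x, V x ≠ 0) (p : M) : stabilizer hV p ≠ ⊤ := by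
  intro h
  apply not_isOpen_singleton_of_chartedSpace_one p
  have hr : range (flow hV p) = {p} := by
    refine Subset.antisymm ?_ (singleton_subset_iff.2 ⟨0, flow_zero hV p⟩)
    rintro _ ⟨t, rfl⟩
    have ht : t ∈ stabilizer hV p := by rw [h]; trivial
    exact ht
  rw [← hr]
  exact (isOpenMap_flow hV hV0 p).isOpen_range

/-- **The stabiliser is infinite cyclic, `ℤ T` with `T > 0`**: a closed subgroup of `ℝ` is
dense or cyclic (`AddSubgroup.dense_or_cyclic`); dense is excluded by `stabilizer_ne_top`, and
the trivial subgroup by compactness — the orbit map would then be a continuous open bijection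
`ℝ → M`, i.e. a homeomorphism onto the compact `M`. [folklore] -/
theorem exists_stabilizer_eq_zmultiples [ConnectedSpace M]
    (hV : ContMDiff (𝓡 1) (𝓡 1).tangent ∞ (fun x => (⟨x, V x⟩ : TangentBundle (𝓡 1) M)))
    (hV0 : ∀ x, V x ≠ 0) (p : M) :
    ∃ T : ℝ, 0 < T ∧ stabilizer hV p = AddSubgroup.zmultiples T := by
  rcases (stabilizer hV p).dense_or_cyclic with hd | ⟨a, ha⟩
  · exfalso
    apply stabilizer_ne_top hV hV0 p
    rw [← AddSubgroup.coe_eq_univ, ← (isClosed_stabilizer hV p).closure_eq]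
    exact hd.closure_eq
  rw [← AddSubgroup.zmultiples_eq_closure] at ha
  rcases lt_trichotomy a 0 with ha0 | rfl | ha0
  · exact ⟨-a, neg_pos.2 ha0, by rw [AddSubgroup.zmultiples_neg]; exact ha⟩
  · exfalso
    have hinj : Injective (flow hV p) := fun s t hst => by
      have h := (flow_eq_flow_iff hV p s t).1 hst
      have h' : s - t ∈ stabilizer hV p := h
      rw [ha, AddSubgroup.zmultiples_zero_eq_bot, AddSubgroup.mem_bot] at h'
      linarith
    have hsurj : Surjective (flow hV p) := fun q => by
      have hq : q ∈ range (flow hV p) := by rw [range_flow_eq_univ hV hV0 p]; trivial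
      exact hq
    let e : ℝ ≃ₜ M := (Equiv.ofBijective _ ⟨hinj, hsurj⟩).toHomeomorphOfContinuousOpen
      (isMIntegralCurve_flow hV p).continuous (isOpenMap_flow hV hV0 p)
    haveI : CompactSpace ℝ := e.symm.compactSpace
    exact not_compactSpace_iff.2 (inferInstance : NoncompactSpace ℝ) inferInstance
  · exact ⟨a, ha0, ha⟩

omit [IsManifold (𝓡 1) ∞ M] [T2Space M] [CompactSpace M] [TopologicalSpace M]
  [ChartedSpace (𝔼 1) M] in
/-- An element of `ℤ T`, `T > 0`, of absolute value `< T` is `0`. [folklore] -/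
theorem eq_zero_of_mem_zmultiples {T t : ℝ} (hT : 0 < T) (ht : t ∈ AddSubgroup.zmultiples T)
    (h : |t| < T) : t = 0 := by
  obtain ⟨n, rfl⟩ := AddSubgroup.mem_zmultiples_iff.1 ht
  have hn : |(n : ℝ)| < 1 := by
    rw [zsmul_eq_mul, abs_mul, abs_of_pos hT] at h
    by_contra hc
    rw [not_lt] at hc
    nlinarith
  have hn0 : n = 0 := by
    rw [← Int.abs_lt_one_iff]
    exact_mod_cast hn
  simp [hn0]

/-! ### The complement of a point is one period of the orbit -/

section Orbit

variable (hV : ContMDiff (𝓡 1) (𝓡 1).tangent ∞ (fun x => (⟨x, V x⟩ : TangentBundle (𝓡 1) M)))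
  (hV0 : ∀ x, V x ≠ 0) (p : M) {T : ℝ} (hT : 0 < T)
  (hS : stabilizer hV p = AddSubgroup.zmultiples T)
include hT hS

/-- During one period the flow does not return to the base point. [folklore] -/
theorem flow_ne_of_mem_Ioo {t : ℝ} (ht : t ∈ Ioo 0 T) : flow hV p t ≠ p := by
  intro h
  have h1 : t ∈ AddSubgroup.zmultiples T := hS ▸ (h : t ∈ stabilizer hV p)
  have h2 := eq_zero_of_mem_zmultiples hT h1 (by rw [abs_of_pos ht.1]; exact ht.2)
  exact ht.1.ne' h2

/-- The orbit map on one period `(0, T)`, into the complement of the base point. [folklore] -/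
def orbitMap (t : Ioo (0 : ℝ) T) : ↥(({p}ᶜ : Set M)) :=
  ⟨flow hV p t, flow_ne_of_mem_Ioo hV p hT hS t.2⟩

/-- The orbit map is injective on one period. [folklore] -/
theorem orbitMap_injective : Injective (orbitMap hV p hT hS) := by
  rintro ⟨s, hs⟩ ⟨t, ht⟩ h
  have h1 : flow hV p s = flow hV p t := congrArg Subtype.val h
  have h2 : s - t ∈ AddSubgroup.zmultiples T := hS ▸ ((flow_eq_flow_iff hV p s t).1 h1)
  have h3 := eq_zero_of_mem_zmultiples hT h2
    (by rw [abs_sub_lt_iff]; constructor <;> linarith [hs.1, hs.2, ht.1, ht.2])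
  exact Subtype.ext (by linarith)

include hV0 in
/-- The orbit map of one period is onto `M ∖ {p}` (the orbit is everything; reduce the time
modulo `T`, Mathlib's `toIcoMod`). [folklore] -/
theorem orbitMap_surjective [ConnectedSpace M] : Surjective (orbitMap hV p hT hS) := by
  rintro ⟨q, hq⟩
  have hq' : q ∈ range (flow hV p) := by rw [range_flow_eq_univ hV hV0 p]; trivial
  obtain ⟨s, rfl⟩ := hq'
  refine ⟨⟨toIcoMod hT 0 s, ?_, ?_⟩, Subtype.ext ?_⟩
  · refine lt_of_le_of_ne (toIcoMod_mem_Ico hT 0 s).1 fun h0 => hq ?_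
    have h1 : s ∈ AddSubgroup.zmultiples T := by
      have h2 := toIcoMod_add_toIcoDiv_zsmul hT 0 s
      rw [← h0, zero_add] at h2
      exact h2 ▸ AddSubgroup.zsmul_mem_zmultiples T _
    exact (hS ▸ h1 : s ∈ stabilizer hV p)
  · simpa using (toIcoMod_mem_Ico hT 0 s).2
  · change flow hV p (toIcoMod hT 0 s) = flow hV p s
    rw [flow_eq_flow_iff]
    change toIcoMod hT 0 s - s ∈ stabilizer hV p
    have h3 : toIcoMod hT 0 s - s = -(toIcoDiv hT 0 s • T) := by
      have := toIcoMod_add_toIcoDiv_zsmul hT 0 s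
      linarith
    rw [hS, h3, neg_mem_iff]
    exact AddSubgroup.zsmul_mem_zmultiples T _

/-- The orbit map is continuous. [folklore] -/
theorem continuous_orbitMap : Continuous (orbitMap hV p hT hS) :=
  ((isMIntegralCurve_flow hV p).continuous.comp continuous_subtype_val).subtype_mk _

include hV0 in
/-- The orbit map is open (the flow curve is, `isOpenMap_flow`). [folklore] -/
theorem isOpenMap_orbitMap : IsOpenMap (orbitMap hV p hT hS) := by
  intro U hU
  have h1 : IsOpen (flow hV p '' (Subtype.val '' U)) :=
    isOpenMap_flow hV hV0 p _ (isOpen_Ioo.isOpenMap_subtype_val U hU)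
  have h2 : orbitMap hV p hT hS '' U = Subtype.val ⁻¹' (flow hV p '' (Subtype.val '' U)) := by
    ext ⟨x, hx⟩
    simp only [mem_image, mem_preimage, orbitMap, Subtype.ext_iff]
    constructor
    · rintro ⟨t, htU, rfl⟩
      exact ⟨t, ⟨t, htU, rfl⟩, rfl⟩
    · rintro ⟨_, ⟨t, htU, rfl⟩, h⟩
      exact ⟨t, htU, h⟩
  rw [h2]
  exact h1.preimage continuous_subtype_val

include hV0 in
/-- **One period of the orbit map is a homeomorphism `(0, T) ≃ₜ M ∖ {p}`** (a continuous open
bijection). This is the tree's form of Milnor's classification of compact connected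
`1`-manifolds (Milnor 1965, Appendix: such an `M` is a circle), proved here along the flow.
[cite: MilnorTDV1965, Appendix (Classifying one-manifolds)] -/
def orbitHomeomorph [ConnectedSpace M] : Ioo (0 : ℝ) T ≃ₜ ↥(({p}ᶜ : Set M)) :=
  (Equiv.ofBijective _
      ⟨orbitMap_injective hV p hT hS, orbitMap_surjective hV hV0 p hT hS⟩).toHomeomorphOfContinuousOpen
    (continuous_orbitMap hV p hT hS) (isOpenMap_orbitMap hV hV0 p hT hS)

end Orbit

/-- **A compact connected `1`-manifold with a nowhere vanishing vector field, minus a point, is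
contractible** (homeomorphic to an open interval, `orbitHomeomorph`). [cite: MilnorTDV1965, Appendix (Classifying one-manifolds)] -/
theorem contractibleSpace_compl_singleton_of_vectorField [ConnectedSpace M]
    (hV : ContMDiff (𝓡 1) (𝓡 1).tangent ∞ (fun x => (⟨x, V x⟩ : TangentBundle (𝓡 1) M)))
    (hV0 : ∀ x, V x ≠ 0) (p : M) : ContractibleSpace ↥(({p}ᶜ : Set M)) := by
  obtain ⟨T, hT, hS⟩ := exists_stabilizer_eq_zmultiples hV hV0 p
  haveI : ContractibleSpace (Ioo (0 : ℝ) T) :=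
    (convex_Ioo 0 T).contractibleSpace (nonempty_Ioo.2 hT)
  exact (orbitHomeomorph hV hV0 p hT hS).symm.contractibleSpace

end Flow

/-- **An oriented compact connected smooth `1`-manifold minus any point is contractible**: it is
homeomorphic to an open interval (Milnor 1965, Appendix, classification of one-manifolds — here
via the flow of a positive vector field, `exists_vectorField_ne_zero` and
`contractibleSpace_compl_singleton_of_vectorField`). [cite: MilnorTDV1965, Appendix (Classifying one-manifolds)] -/
theorem contractibleSpace_compl_singleton_of_smoothOrientation_one {M : Type*}
    [TopologicalSpace M] [ChartedSpace (𝔼 1) M] [IsManifold (𝓡 1) ∞ M] [T2Space M]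
    [CompactSpace M] [ConnectedSpace M] (o : SmoothOrientation (𝓡 1) M) (p : M) :
    ContractibleSpace ↥(({p}ᶜ : Set M)) := by
  obtain ⟨V, hV, hV0⟩ := exists_vectorField_ne_zero o
  exact contractibleSpace_compl_singleton_of_vectorField hV hV0 p

end Literature.Topology.FourManifolds
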